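import Summits.AtomisticToContinuum.FouriersLaw.Theorems.EmbeddedDrudeMourreGreenKuboContinuationCanonicalSeed
import Literature.MathematicalPhysics.KineticTheory.InfiniteChainSuperstableOrbits

/-!
# `stub_canonicalSeedOfRegularState` of line `temperature-blind-vitali-hurwitz` (rev 3)
(crux `EmbeddedDrudeMourre.GreenKuboContinuation`, item stmt-AtomisticToContinuum-12597; `--supports`
helper file, closes nothing)

The registered stub: for a regular thermal family `(μ, D)` of `P = pinnedChain ω₂ lam β γ`
(`D.carrier = bmGood P`) and `T > 0`, IF DLR states in the regular class at `T` are unique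
(statement of `stub_regularDLRUnique` at `T`, a hypothesis here) and an Abelian Green–Kubo witness
`(μT, D', κ)` exists at `T` whose STATE is regular (DLR, shift-invariant, BM-superstable) while the
dynamics `D'` is ARBITRARY (any `μT`-preserving `InfiniteChainDynamics` with absolutely convergent
correlations), THEN the canonical Abel functional `T⁻² ∫₀^∞ e^{-νt} C_{D, μ T}(t) dt` converges to
some `κ' > 0` as `ν → 0⁺`.

Proof. The tree theorem `OscillatorChain.ae_forall_flow_mem_bmGood_pinnedChain`
(`Literature/…/InfiniteChainSuperstableOrbits`, the sup-in-time form of Buttà–Marchioro 2016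
eq. (2.6)) says that `μT`-a.e. `D'`-orbit lies in `bmGood P` at ALL times, because `μT` is
superstable and `D'` preserves it. Restricting `D'` to the flow-invariant set
`{σ ∈ D'.carrier | ∀ t, D'.flow t σ ∈ bmGood}` (`exists_restrictOrbits`: same flow, hence literally
the same `currentCorrelation`, `HasAbsConvergentCorrelation` and — the new carrier having full
measure — `PreservesMeasure`) produces a witness WITH `carrier ⊆ bmGood`
(`regularWitness_of_regularState_of_aeOrbits`), to which the landed rev-2 theorem
`stub_canonicalSeed` (`…Theorems.EmbeddedDrudeMourreGreenKuboContinuationCanonicalSeed`) applies.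
§1 is the wave-2 worker's restriction lemmas (work file `stub_witnessRegularisation.lean`, not
landed), reproduced verbatim.
-/

noncomputable section

namespace Summit.AtomisticToContinuum.FouriersLaw.Theorems.GreenKuboContinuation.TemperatureBlindVitaliHurwitz

open Filter Topology MeasureTheory Set
open Literature.MathematicalPhysics.KineticTheory.HeatConduction

/-! ## §1 Restricting a dynamics to the orbits that stay inside a set
(from the wave-2 analysis file `stub_witnessRegularisation.lean` of this line) -/

/-- **Restriction to orbits inside `S`.** For any dynamics `D` and any set `S`, the set of carrier
points whose whole `D`-orbit lies in `S` is flow-invariant (group law), and `D` restricted to it —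
same flow — is again an `InfiniteChainDynamics` (uniqueness is inherited from the larger carrier).
[folklore] -/
theorem exists_restrictOrbits {P : OscillatorChain} (D : InfiniteChainDynamics P)
    (S : Set ChainConfig) :
    ∃ D'' : InfiniteChainDynamics P,
      D''.carrier = {σ | σ ∈ D.carrier ∧ ∀ t : ℝ, D.flow t σ ∈ S} ∧ D''.flow = D.flow := by
  refine ⟨⟨{σ | σ ∈ D.carrier ∧ ∀ t : ℝ, D.flow t σ ∈ S}, D.flow, ?_, ?_, ?_, ?_⟩, rfl, rfl⟩
  · intro t σ hσ
    refine ⟨D.flow_mem hσ.1 t, fun s => ?_⟩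
    rw [← D.flow_add hσ.1 s t]
    exact hσ.2 (s + t)
  · exact fun σ hσ => D.flow_zero σ hσ.1
  · exact fun σ hσ => D.isSolution σ hσ.1
  · exact fun γ hγ hsol t => D.unique γ (fun u => (hγ u).1) hsol t

/-- Two dynamics with the same flow have the same current autocorrelation. [folklore] -/
theorem currentCorrelation_eq_of_flow_eq {P : OscillatorChain} {D D'' : InfiniteChainDynamics P}
    (h : D''.flow = D.flow) (μ : Measure ChainConfig) :
    D''.currentCorrelation μ = D.currentCorrelation μ := by
  funext t
  simp only [InfiniteChainDynamics.currentCorrelation, h]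

/-- Two dynamics with the same flow have the same absolute-convergence predicate. [folklore] -/
theorem hasAbsConvergentCorrelation_iff_of_flow_eq {P : OscillatorChain}
    {D D'' : InfiniteChainDynamics P} (h : D''.flow = D.flow) (μ : Measure ChainConfig) (t : ℝ) :
    D''.HasAbsConvergentCorrelation μ t ↔ D.HasAbsConvergentCorrelation μ t := by
  simp only [InfiniteChainDynamics.HasAbsConvergentCorrelation, h]

/-- Same flow, carrier of full measure: measure preservation transfers. [folklore] -/
theorem preservesMeasure_of_flow_eq {P : OscillatorChain} {D D'' : InfiniteChainDynamics P}
    (h : D''.flow = D.flow) {μ : Measure ChainConfig} (hcar : ∀ᵐ σ ∂μ, σ ∈ D''.carrier)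
    (hP : D.PreservesMeasure μ) : D''.PreservesMeasure μ :=
  ⟨hcar, fun t => by rw [h]; exact hP.2 t⟩

/-! ## §2 A witness with regular STATE and a.e. good ORBITS is a regular witness -/

/-- **Regularisation of the dynamics half.** If the witness state `μT` is shift-invariant and
BM-superstable and `μT`-a.e. `D'`-orbit stays in `bmGood P` at all times, then
`(μT, D'|_{orbits ⊆ bmGood}, κ)` is a regular witness: the restricted dynamics has carrier
`⊆ bmGood`, the same flow, hence the same `PreservesMeasure`, correlations and Abel limit.
[folklore] -/
theorem regularWitness_of_regularState_of_aeOrbits {ω₂ lam β γ T κ : ℝ}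
    {μT : Measure ChainConfig} (D' : InfiniteChainDynamics (pinnedChain ω₂ lam β γ))
    (hG : (pinnedChain ω₂ lam β γ).IsChainGibbsMeasure T μT) (hP : D'.PreservesMeasure μT)
    (hAC : ∀ t : ℝ, D'.HasAbsConvergentCorrelation μT t) (hκ : 0 < κ)
    (hlim : Tendsto (fun ν : ℝ => (T ^ 2)⁻¹ *
        ∫ t in Ioi (0:ℝ), Real.exp (-(ν * t)) * D'.currentCorrelation μT t) (𝓝[>] 0) (𝓝 κ))
    (hS : IsShiftInvariant μT) (hss : (pinnedChain ω₂ lam β γ).HasSuperstabilityEstimate μT)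
    (horb : ∀ᵐ σ ∂μT, ∀ t : ℝ, D'.flow t σ ∈ (pinnedChain ω₂ lam β γ).bmGood) :
    ∃ (μT' : Measure ChainConfig) (D'' : InfiniteChainDynamics (pinnedChain ω₂ lam β γ))
        (κ' : ℝ),
      (pinnedChain ω₂ lam β γ).IsChainGibbsMeasure T μT' ∧ IsShiftInvariant μT' ∧
      (pinnedChain ω₂ lam β γ).HasSuperstabilityEstimate μT' ∧
      D''.carrier ⊆ (pinnedChain ω₂ lam β γ).bmGood ∧ D''.PreservesMeasure μT' ∧
      (∀ t : ℝ, D''.HasAbsConvergentCorrelation μT' t) ∧ 0 < κ' ∧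
      Tendsto (fun ν : ℝ => (T ^ 2)⁻¹ *
        ∫ t in Ioi (0:ℝ), Real.exp (-(ν * t)) * D''.currentCorrelation μT' t)
        (𝓝[>] 0) (𝓝 κ') := by
  obtain ⟨D'', hcar, hflow⟩ := exists_restrictOrbits D' (pinnedChain ω₂ lam β γ).bmGood
  refine ⟨μT, D'', κ, hG, hS, hss, ?_, ?_, ?_, hκ, ?_⟩
  · intro σ hσ
    rw [hcar] at hσ
    have h0 := hσ.2 0
    rwa [D'.flow_zero σ hσ.1] at h0
  · refine preservesMeasure_of_flow_eq hflow ?_ hP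
    rw [hcar]
    filter_upwards [hP.1, horb] with σ h1 h2 using ⟨h1, h2⟩
  · intro t
    rw [hasAbsConvergentCorrelation_iff_of_flow_eq hflow]
    exact hAC t
  · rw [currentCorrelation_eq_of_flow_eq hflow]
    exact hlim

/-! ## §3 The registered stub -/

/-- **`stub_canonicalSeedOfRegularState` (rev 3), PROVED.** For a regular thermal family `(μ, D)`
of the pinned chain and `T > 0`: DLR uniqueness in the regular class at `T` (hypothesis) and an
Abelian Green–Kubo witness `(μT, D', κ)` at `T` with REGULAR STATE (DLR, shift-invariant,
superstable) and ARBITRARY `μT`-preserving dynamics `D'` force the canonical Abel functional of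
`(D, μ T)` to converge to some `κ' > 0`. Proof: a.e. `D'`-orbit is in `bmGood` at all times
(`OscillatorChain.ae_forall_flow_mem_bmGood_pinnedChain`, sup-in-time BM (2.6)); restrict `D'` to
those orbits (`regularWitness_of_regularState_of_aeOrbits`); apply the landed rev-2
`stub_canonicalSeed`. [folklore] -/
theorem stub_canonicalSeedOfRegularState :
    ∀ ω₂ lam β γ : ℝ, 0 < ω₂ → 0 < lam → 0 < β → 0 < γ →
      ∀ (μ : ℝ → MeasureTheory.Measure
            Literature.MathematicalPhysics.KineticTheory.HeatConduction.ChainConfig)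
        (D : Literature.MathematicalPhysics.KineticTheory.HeatConduction.InfiniteChainDynamics
          (Literature.MathematicalPhysics.KineticTheory.HeatConduction.pinnedChain ω₂ lam β γ)),
        (D.carrier =
            (Literature.MathematicalPhysics.KineticTheory.HeatConduction.pinnedChain
              ω₂ lam β γ).bmGood ∧
          ∀ T : ℝ, 0 < T →
            (Literature.MathematicalPhysics.KineticTheory.HeatConduction.pinnedChain
                ω₂ lam β γ).IsChainGibbsMeasure T (μ T) ∧
            Literature.MathematicalPhysics.KineticTheory.HeatConduction.IsShiftInvariant (μ T) ∧
            (Literature.MathematicalPhysics.KineticTheory.HeatConduction.pinnedChain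
                ω₂ lam β γ).HasSuperstabilityEstimate (μ T) ∧
            D.PreservesMeasure (μ T) ∧
            (∀ t : ℝ, D.HasAbsConvergentCorrelation (μ T) t) ∧
            (∀ ν : ℝ, 0 < ν →
              0 < MeasureTheory.integral (MeasureTheory.volume.restrict (Set.Ioi (0:ℝ)))
                (fun t : ℝ => Real.exp (-(ν * t)) * D.currentCorrelation (μ T) t))) →
        ∀ T : ℝ, 0 < T →
          (∀ μ₁ μ₂ : MeasureTheory.Measure
              Literature.MathematicalPhysics.KineticTheory.HeatConduction.ChainConfig,
            (Literature.MathematicalPhysics.KineticTheory.HeatConduction.pinnedChain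
                ω₂ lam β γ).IsChainGibbsMeasure T μ₁ →
            Literature.MathematicalPhysics.KineticTheory.HeatConduction.IsShiftInvariant μ₁ →
            (Literature.MathematicalPhysics.KineticTheory.HeatConduction.pinnedChain
                ω₂ lam β γ).HasSuperstabilityEstimate μ₁ →
            (Literature.MathematicalPhysics.KineticTheory.HeatConduction.pinnedChain
                ω₂ lam β γ).IsChainGibbsMeasure T μ₂ →
            Literature.MathematicalPhysics.KineticTheory.HeatConduction.IsShiftInvariant μ₂ →
            (Literature.MathematicalPhysics.KineticTheory.HeatConduction.pinnedChain
                ω₂ lam β γ).HasSuperstabilityEstimate μ₂ → μ₁ = μ₂) →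
          (∃ (μT : MeasureTheory.Measure
                Literature.MathematicalPhysics.KineticTheory.HeatConduction.ChainConfig)
            (D' : Literature.MathematicalPhysics.KineticTheory.HeatConduction.InfiniteChainDynamics
              (Literature.MathematicalPhysics.KineticTheory.HeatConduction.pinnedChain ω₂ lam β γ))
            (κ : ℝ),
            (Literature.MathematicalPhysics.KineticTheory.HeatConduction.pinnedChain
                ω₂ lam β γ).IsChainGibbsMeasure T μT ∧
            Literature.MathematicalPhysics.KineticTheory.HeatConduction.IsShiftInvariant μT ∧
            (Literature.MathematicalPhysics.KineticTheory.HeatConduction.pinnedChain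
                ω₂ lam β γ).HasSuperstabilityEstimate μT ∧
            D'.PreservesMeasure μT ∧
            (∀ t : ℝ, D'.HasAbsConvergentCorrelation μT t) ∧ 0 < κ ∧
            Filter.Tendsto (fun ν : ℝ => (T ^ 2)⁻¹ *
              MeasureTheory.integral (MeasureTheory.volume.restrict (Set.Ioi (0:ℝ)))
                (fun t : ℝ => Real.exp (-(ν * t)) * D'.currentCorrelation μT t))
              (nhdsWithin (0:ℝ) (Set.Ioi 0)) (nhds κ)) →
          ∃ κ : ℝ, 0 < κ ∧
            Filter.Tendsto (fun ν : ℝ => (T ^ 2)⁻¹ *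
              MeasureTheory.integral (MeasureTheory.volume.restrict (Set.Ioi (0:ℝ)))
                (fun t : ℝ => Real.exp (-(ν * t)) * D.currentCorrelation (μ T) t))
              (nhdsWithin (0:ℝ) (Set.Ioi 0)) (nhds κ) := by
  intro ω₂ lam β γ hω hl hβ hγ μ D hreg T hT hF1 hW
  obtain ⟨μT, D', κ, hG, hS, hss, hP, hAC, hκ, hlim⟩ := hW
  have horb : ∀ᵐ σ ∂μT, ∀ t : ℝ, D'.flow t σ ∈ (pinnedChain ω₂ lam β γ).bmGood :=
    OscillatorChain.ae_forall_flow_mem_bmGood_pinnedChain γ hω.le hl hβ hss D' hP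
  obtain ⟨μT', D'', κ', h1, h2, h3, h4, h5, h6, h7, h8⟩ :=
    regularWitness_of_regularState_of_aeOrbits D' hG hP hAC hκ hlim hS hss horb
  exact stub_canonicalSeed ω₂ lam β γ hω hl hβ hγ μ D hreg T hT hF1
    ⟨μT', D'', κ', h1, h2, h3, h4, h5, h6, h7, h8⟩

end Summit.AtomisticToContinuum.FouriersLaw.Theorems.GreenKuboContinuation.TemperatureBlindVitaliHurwitz

end
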